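import Mathlib.RingTheory.Valuation.ValuativeRel.Basic
import Mathlib.RingTheory.Valuation.Integers
import Mathlib.Topology.Algebra.Valued.ValuativeRel
import Mathlib.Algebra.GroupWithZero.Associated
import Mathlib.GroupTheory.QuotientGroup.Basic
import Literature.AlgebraicGeometry.Frobenioids.Monoids
import HarnessLib

/-!
# Frobenioids II, Example 1.1 (i): the monoids `O_K^⊳`, `ord(O_K^⊳)`, `ord(K^×)` of a valued field

Mochizuki, *The geometry of Frobenioids II*, Kyushu J. Math. **62** (2008) 401–460, §1 Example 1.1
(i), author's text p. 7 [cite: MochizukiFrdII2008, Ex 1.1 (i) p.7]: for a finite extension `K` of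
`ℚ_p` one writes `O_K` for the ring of integers, `O_K^× ⊆ O_K` for the units, `O_K^⊳ ⊆ O_K` for the
multiplicative monoid of nonzero elements, `ord(O_K^⊳) := O_K^⊳/O_K^× ⊆ ord(K^×) := K^×/O_K^×`,
and uses the natural surjection `K^× ↠ ord(K^×)`. These are the FIBRE DATA of the monoids `Φ₀`
("`Spec K ↦ ord(O_K^⊳)^rlf`") and `B₀` ("`Spec K ↦ K^×`", with `B₀ → Φ₀^gp` "by considering the
natural surjection `K^× ↠ ord(K^×)`") on the base category `D₀` of Example 1.1.

**Generality / dictionary.** Everything on p. 7 that concerns ONE field uses only its valuation, so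
we work with a field `K` carrying a `ValuativeRel` (Mathlib), `v := ValuativeRel.valuation K`,
`O_K := 𝒪[K] = v.integer`; a finite extension of `ℚ_p` with its `p`-adic valuation is the case in
print. Following the dictionary of `Monoids.lean` (monoids written multiplicatively,
`M^char = M/M^± ↦ Associates M`): `ord(O_K^⊳) = Associates O_K^⊳`, `ord(K^×) = Kˣ ⧸ O_K^×`.
The maps along an extension `L ⊆ K` (the restriction maps of `Φ₀`, `B₀` along an arrow
`Spec K → Spec L` of `D₀`) are given for Mathlib's `ValuativeExtension L K`.

**Contents.** `intNonzero K = O_K^⊳` (a submonoid of `K`), `unitSubgroup K = O_K^×` (a subgroup of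
`Kˣ`), `OrdInt K = ord(O_K^⊳)`, `OrdUnits K = ord(K^×)`, the natural surjection
`ordUnitsMk : Kˣ ↠ ord(K^×)`, the inclusion `ordIntToOrdUnits : ord(O_K^⊳) → ord(K^×)` (proved
injective), the identification `ord(K^×) ≃* (value group of v)` (proved), and the maps
`O_L^⊳ → O_K^⊳`, `ord(O_L^⊳) → ord(O_K^⊳)`, `ord(L^×) → ord(K^×)` along a valuative extension.
Deliberately NOT here: the realification `ord(O_K^⊳)^rlf (≅ ℝ_{≥0})` ([FrdI] Def. 2.4 (i), typed
with [FrdI] §2), the base category `D₀` and the model Frobenioid `C₀` (they need [FrdI] Thm. 5.2;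
see the Frobenioid-level file for Example 1.1 (ii) / Theorem 1.2).
-/

namespace Literature.AlgebraicGeometry.Frobenioids

open scoped ValuativeRel
open ValuativeRel Function

universe u

namespace PadicFrd

variable (K : Type u) [Field K] [ValuativeRel K]

/-- `O_K^⊳ ⊆ O_K`: the multiplicative monoid of nonzero integers of the valued field `K`, as a
submonoid of `K` (FrdII Ex. 1.1 (i), p. 7). [cite: MochizukiFrdII2008, Ex 1.1 (i) p.7] -/
def intNonzero : Submonoid K where
  carrier := {x | valuation K x ≤ 1 ∧ x ≠ 0}
  mul_mem' := by
    rintro a b ⟨ha, ha0⟩ ⟨hb, hb0⟩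
    refine ⟨?_, mul_ne_zero ha0 hb0⟩
    rw [map_mul]
    exact mul_le_one' ha hb
  one_mem' := ⟨by rw [map_one], one_ne_zero⟩

/-- Membership in `O_K^⊳`: integral and nonzero. [cite: MochizukiFrdII2008, Ex 1.1 (i) p.7] -/
theorem mem_intNonzero_iff {x : K} : x ∈ intNonzero K ↔ valuation K x ≤ 1 ∧ x ≠ 0 := Iff.rfl

/-- `O_K^⊳ ⊆ O_K` (FrdII Ex. 1.1 (i), p. 7). [cite: MochizukiFrdII2008, Ex 1.1 (i) p.7] -/
theorem mem_integer_of_mem_intNonzero {x : K} (hx : x ∈ intNonzero K) : x ∈ 𝒪[K] :=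
  (Valuation.mem_integer_iff _ _).mpr hx.1

/-- `O_K^× ⊆ K^×`: the units of `O_K`, as the subgroup of `Kˣ` of elements of valuation `1`
(FrdII Ex. 1.1 (i), p. 7). [cite: MochizukiFrdII2008, Ex 1.1 (i) p.7] -/
def unitSubgroup : Subgroup Kˣ where
  carrier := {u | valuation K (u : K) = 1}
  mul_mem' := by
    intro a b ha hb
    simp only [Set.mem_setOf_eq, Units.val_mul, map_mul] at *
    rw [ha, hb, mul_one]
  one_mem' := by simp
  inv_mem' := by
    intro a ha
    simp only [Set.mem_setOf_eq] at *
    rw [Units.val_inv_eq_inv_val, map_inv₀, ha, inv_one]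

/-- Membership in `O_K^×`: valuation exactly `1`. [cite: MochizukiFrdII2008, Ex 1.1 (i) p.7] -/
theorem mem_unitSubgroup_iff {u : Kˣ} : u ∈ unitSubgroup K ↔ valuation K (u : K) = 1 := Iff.rfl

/-- An element of `O_K^×` lies in `O_K^⊳`. [cite: MochizukiFrdII2008, Ex 1.1 (i) p.7] -/
theorem val_mem_intNonzero_of_mem_unitSubgroup {u : Kˣ} (hu : u ∈ unitSubgroup K) :
    (u : K) ∈ intNonzero K :=
  ⟨le_of_eq hu, u.ne_zero⟩

/-- The units of the monoid `O_K^⊳` are exactly the elements of valuation `1`, i.e. `(O_K^⊳)^± =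
O_K^×` (implicit in "`ord(O_K^⊳) := O_K^⊳/O_K^×`", FrdII Ex. 1.1 (i), p. 7).
[cite: MochizukiFrdII2008, Ex 1.1 (i) p.7] -/
theorem isUnit_intNonzero_iff (x : intNonzero K) : IsUnit x ↔ valuation K (x : K) = 1 := by
  constructor
  · rintro ⟨u, rfl⟩
    apply le_antisymm (u : intNonzero K).2.1
    -- `v(u) * v(u⁻¹) = 1` with both factors `≤ 1`
    have h : valuation K ((u : intNonzero K) : K) * valuation K ((u⁻¹ : (intNonzero K)ˣ) : K) = 1 := by
      rw [← map_mul, ← Submonoid.coe_mul, ← Units.val_mul, mul_inv_cancel, Units.val_one,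
        Submonoid.coe_one, map_one]
    by_contra hlt
    rw [not_le] at hlt
    have := mul_lt_one_of_lt_of_le hlt (u⁻¹ : (intNonzero K)ˣ).val.2.1
    exact absurd h this.ne
  · intro hx
    have hx0 : (x : K) ≠ 0 := x.2.2
    have hinv : valuation K (x : K)⁻¹ ≤ 1 ∧ (x : K)⁻¹ ≠ 0 :=
      ⟨by rw [map_inv₀, hx, inv_one], inv_ne_zero hx0⟩
    refine ⟨⟨x, ⟨(x : K)⁻¹, hinv⟩, ?_, ?_⟩, rfl⟩
    · exact Subtype.ext (mul_inv_cancel₀ hx0)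
    · exact Subtype.ext (inv_mul_cancel₀ hx0)

/-- `ord(O_K^⊳) := O_K^⊳/O_K^×`, the quotient of the monoid of nonzero integers by its units
(FrdII Ex. 1.1 (i), p. 7; `M/M^± = Associates M` in the dictionary of `Monoids.lean`).
[cite: MochizukiFrdII2008, Ex 1.1 (i) p.7] -/
abbrev OrdInt : Type u := Associates (intNonzero K)

/-- `ord(K^×) := K^×/O_K^×` (FrdII Ex. 1.1 (i), p. 7). [cite: MochizukiFrdII2008, Ex 1.1 (i) p.7] -/
abbrev OrdUnits : Type u := Kˣ ⧸ unitSubgroup K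

/-- "The natural surjection `K^× ↠ ord(K^×)`" (FrdII Ex. 1.1 (i), p. 7), through which
`B₀(Spec K) = K^×` maps to `Φ₀^gp`. [cite: MochizukiFrdII2008, Ex 1.1 (i) p.7] -/
def ordUnitsMk : Kˣ →* OrdUnits K := QuotientGroup.mk' (unitSubgroup K)

/-- `K^× ↠ ord(K^×)` is surjective. [cite: MochizukiFrdII2008, Ex 1.1 (i) p.7] -/
theorem ordUnitsMk_surjective : Surjective (ordUnitsMk K) := QuotientGroup.mk'_surjective _

/-- The kernel of `K^× ↠ ord(K^×)` is `O_K^×`. [cite: MochizukiFrdII2008, Ex 1.1 (i) p.7] -/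
theorem ker_ordUnitsMk : (ordUnitsMk K).ker = unitSubgroup K := QuotientGroup.ker_mk' _

/-- `O_K^⊳ → K^×`: a nonzero integer as a unit of the field `K`.
[cite: MochizukiFrdII2008, Ex 1.1 (i) p.7] -/
def intNonzeroToUnits : intNonzero K →* Kˣ where
  toFun x := Units.mk0 (x : K) x.2.2
  map_one' := Units.ext rfl
  map_mul' _ _ := Units.ext rfl

/-- The value of `intNonzeroToUnits`. [cite: MochizukiFrdII2008, Ex 1.1 (i) p.7] -/
@[simp] theorem coe_intNonzeroToUnits (x : intNonzero K) : (intNonzeroToUnits K x : K) = x := rfl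

/-- Associated elements of `O_K^⊳` have the same image in `ord(K^×)`: the unit by which they differ
has valuation `1`. [cite: MochizukiFrdII2008, Ex 1.1 (i) p.7] -/
theorem ordUnitsMk_intNonzeroToUnits_eq_of_associated {x y : intNonzero K} (h : Associated x y) :
    ordUnitsMk K (intNonzeroToUnits K x) = ordUnitsMk K (intNonzeroToUnits K y) := by
  obtain ⟨u, rfl⟩ := h
  rw [map_mul, map_mul]
  have hu : intNonzeroToUnits K (u : intNonzero K) ∈ unitSubgroup K := by
    rw [mem_unitSubgroup_iff, coe_intNonzeroToUnits]
    exact (isUnit_intNonzero_iff K _).mp u.isUnit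
  have h1 : ordUnitsMk K (intNonzeroToUnits K (u : intNonzero K)) = 1 := by
    rw [ordUnitsMk, QuotientGroup.mk'_apply, QuotientGroup.eq_one_iff]
    exact hu
  rw [h1]
  exact (mul_one (ordUnitsMk K (intNonzeroToUnits K x))).symm

/-- The inclusion `ord(O_K^⊳) ⊆ ord(K^×)` induced by `O_K^⊳ ⊆ K^×` (FrdII Ex. 1.1 (i), p. 7).
[cite: MochizukiFrdII2008, Ex 1.1 (i) p.7] -/
def ordIntToOrdUnits : OrdInt K →* OrdUnits K where
  toFun := Quotient.lift (fun x : intNonzero K => ordUnitsMk K (intNonzeroToUnits K x))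
    (fun _ _ h => ordUnitsMk_intNonzeroToUnits_eq_of_associated K h)
  map_one' := by
    rw [Associates.one_eq_mk_one, ← Associates.quotient_mk_eq_mk, Quotient.lift_mk, map_one, map_one]
  map_mul' a b := by
    obtain ⟨a, rfl⟩ := Associates.mk_surjective a
    obtain ⟨b, rfl⟩ := Associates.mk_surjective b
    rw [Associates.mk_mul_mk, ← Associates.quotient_mk_eq_mk, ← Associates.quotient_mk_eq_mk,
      ← Associates.quotient_mk_eq_mk, Quotient.lift_mk, Quotient.lift_mk, Quotient.lift_mk,
      map_mul, map_mul]

/-- `ord(O_K^⊳) → ord(K^×)` on representatives. [cite: MochizukiFrdII2008, Ex 1.1 (i) p.7] -/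
@[simp] theorem ordIntToOrdUnits_mk (x : intNonzero K) :
    ordIntToOrdUnits K (Associates.mk x) = ordUnitsMk K (intNonzeroToUnits K x) := rfl

/-- "`ord(O_K^⊳) ⊆ ord(K^×)`": the natural map is injective (FrdII Ex. 1.1 (i), p. 7).
[cite: MochizukiFrdII2008, Ex 1.1 (i) p.7] -/
theorem ordIntToOrdUnits_injective : Injective (ordIntToOrdUnits K) := by
  refine Associates.forall_associated.mpr fun x => Associates.forall_associated.mpr fun y h => ?_
  rw [ordIntToOrdUnits_mk, ordIntToOrdUnits_mk, ordUnitsMk, QuotientGroup.mk'_apply,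
    QuotientGroup.mk'_apply, QuotientGroup.eq, mem_unitSubgroup_iff] at h
  -- `h : v(x⁻¹ y) = 1`; so `y = x · (x⁻¹ y)` with `x⁻¹ y ∈ O_K^⊳` a unit
  rw [Associates.mk_eq_mk_iff_associated]
  have hx0 : (x : K) ≠ 0 := x.2.2
  have hq : valuation K ((x : K)⁻¹ * y) = 1 := by
    simpa only [Units.val_mul, Units.val_inv_eq_inv_val, coe_intNonzeroToUnits] using h
  let q : intNonzero K := ⟨(x : K)⁻¹ * y, le_of_eq hq, mul_ne_zero (inv_ne_zero hx0) y.2.2⟩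
  have hqu : IsUnit q := (isUnit_intNonzero_iff K q).mpr hq
  obtain ⟨u, hu⟩ := hqu
  refine ⟨u, Subtype.ext ?_⟩
  change (x : K) * ((u : intNonzero K) : K) = y
  rw [hu]
  change (x : K) * ((x : K)⁻¹ * y) = y
  rw [← mul_assoc, mul_inv_cancel₀ hx0, one_mul]

/-! ### `ord(K^×)` is the value group -/

/-- `K^× → (value group)ˣ`, `x ↦ v(x)`. [cite: MochizukiFrdII2008, Ex 1.1 (i) p.7] -/
noncomputable def unitsToValueGroup : Kˣ →* (ValueGroupWithZero K)ˣ :=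
  Units.map (valuation K).toMonoidWithZeroHom.toMonoidHom

/-- The value of `unitsToValueGroup`. [cite: MochizukiFrdII2008, Ex 1.1 (i) p.7] -/
@[simp] theorem coe_unitsToValueGroup (x : Kˣ) :
    (unitsToValueGroup K x : ValueGroupWithZero K) = valuation K (x : K) := rfl

/-- `K^× → (value group)ˣ` is surjective. [cite: MochizukiFrdII2008, Ex 1.1 (i) p.7] -/
theorem unitsToValueGroup_surjective : Surjective (unitsToValueGroup K) := by
  intro γ
  obtain ⟨x, hx⟩ := ValuativeRel.valuation_surjective (γ : ValueGroupWithZero K)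
  have hx0 : x ≠ 0 := by
    rintro rfl
    rw [map_zero] at hx
    exact γ.ne_zero hx.symm
  exact ⟨Units.mk0 x hx0, Units.ext (by simpa using hx)⟩

/-- The kernel of `K^× → (value group)ˣ` is `O_K^×`. [cite: MochizukiFrdII2008, Ex 1.1 (i) p.7] -/
theorem ker_unitsToValueGroup : (unitsToValueGroup K).ker = unitSubgroup K := by
  ext u
  rw [MonoidHom.mem_ker, mem_unitSubgroup_iff, Units.ext_iff, coe_unitsToValueGroup, Units.val_one]

/-- `ord(K^×) = K^×/O_K^×` is canonically the value group of `K` (so "`≅ ℤ`" for a finite extension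
of `ℚ_p`, FrdII Ex. 1.1 (i), pp. 7–8: "`ord(V) (≅ ℤ)`"). [cite: MochizukiFrdII2008, Ex 1.1 (i) pp.7-8] -/
noncomputable def ordUnitsEquivValueGroup : OrdUnits K ≃* (ValueGroupWithZero K)ˣ :=
  (QuotientGroup.quotientMulEquivOfEq (ker_unitsToValueGroup K).symm).trans
    (QuotientGroup.quotientKerEquivOfSurjective _ (unitsToValueGroup_surjective K))

/-- The identification `ord(K^×) ≅ value group` sends the class of `x ∈ K^×` to `v(x)`.
[cite: MochizukiFrdII2008, Ex 1.1 (i) pp.7-8] -/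
@[simp] theorem ordUnitsEquivValueGroup_mk (x : Kˣ) :
    ordUnitsEquivValueGroup K (ordUnitsMk K x) = unitsToValueGroup K x := rfl

/-! ### The maps along an extension `L ⊆ K` (restriction maps of `Φ₀`, `B₀`) -/

section Extension

variable (L : Type u) [Field L] [ValuativeRel L] [Algebra L K] [ValuativeExtension L K]

/-- Along a valuative extension `L ⊆ K`: `v_K(x) ≤ 1 ↔ v_L(x) ≤ 1` for `x ∈ L`.
[cite: MochizukiFrdII2008, Ex 1.1 (i) p.7] -/
theorem valuation_algebraMap_le_one_iff (x : L) :
    valuation K (algebraMap L K x) ≤ 1 ↔ valuation L x ≤ 1 := by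
  rw [← (valuation K).vle_one_iff, ← (valuation L).vle_one_iff, ← map_one (algebraMap L K),
    ValuativeExtension.vle_iff_vle]

/-- Along a valuative extension `L ⊆ K`: `v_K(x) = 1 ↔ v_L(x) = 1` for `x ∈ L`.
[cite: MochizukiFrdII2008, Ex 1.1 (i) p.7] -/
theorem valuation_algebraMap_eq_one_iff (x : L) :
    valuation K (algebraMap L K x) = 1 ↔ valuation L x = 1 := by
  have h1 : valuation K (algebraMap L K x) = 1 ↔ algebraMap L K x =ᵥ algebraMap L K 1 := by
    rw [(valuation K).veq_iff_eq, map_one (algebraMap L K), map_one (valuation K)]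
  have h2 : valuation L x = 1 ↔ x =ᵥ (1 : L) := by
    rw [(valuation L).veq_iff_eq, map_one (valuation L)]
  rw [h1, h2, veq_def, veq_def, ValuativeExtension.vle_iff_vle, ValuativeExtension.vle_iff_vle]

/-- `O_L^⊳ → O_K^⊳` along `L ⊆ K` (restriction map of `Spec K ↦ O_K^⊳` along `Spec K → Spec L`).
[cite: MochizukiFrdII2008, Ex 1.1 (i) p.7] -/
def intNonzeroMap : intNonzero L →* intNonzero K where
  toFun x := ⟨algebraMap L K x, (valuation_algebraMap_le_one_iff K L _).mpr x.2.1,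
    (map_ne_zero (algebraMap L K)).mpr x.2.2⟩
  map_one' := Subtype.ext (map_one _)
  map_mul' _ _ := Subtype.ext (map_mul _ _ _)

/-- The value of `intNonzeroMap`. [cite: MochizukiFrdII2008, Ex 1.1 (i) p.7] -/
@[simp] theorem coe_intNonzeroMap (x : intNonzero L) :
    (intNonzeroMap K L x : K) = algebraMap L K x := rfl

/-- `ord(O_L^⊳) → ord(O_K^⊳)` along `L ⊆ K`: the restriction map of the monoid `Φ₀` of Example 1.1
(before realification). [cite: MochizukiFrdII2008, Ex 1.1 (i) p.7] -/
def ordIntMap : OrdInt L →* OrdInt K := associatesMap (intNonzeroMap K L)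

/-- `L^× → K^×` along `L ⊆ K`: the restriction map of the monoid `B₀ : Spec K ↦ K^×` of Example 1.1.
[cite: MochizukiFrdII2008, Ex 1.1 (i) p.7] -/
def unitsMap : Lˣ →* Kˣ := Units.map (algebraMap L K : L →* K)

/-- `L^× → K^×` maps `O_L^×` into `O_K^×`. [cite: MochizukiFrdII2008, Ex 1.1 (i) p.7] -/
theorem unitsMap_mem_unitSubgroup {u : Lˣ} (hu : u ∈ unitSubgroup L) :
    unitsMap K L u ∈ unitSubgroup K := by
  rw [mem_unitSubgroup_iff] at hu ⊢
  exact (valuation_algebraMap_eq_one_iff K L _).mpr hu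

/-- `ord(L^×) → ord(K^×)` along `L ⊆ K`. [cite: MochizukiFrdII2008, Ex 1.1 (i) p.7] -/
def ordUnitsMap : OrdUnits L →* OrdUnits K :=
  QuotientGroup.map _ _ (unitsMap K L) fun _ hu => unitsMap_mem_unitSubgroup K L hu

/-- The restriction maps commute with the natural surjections `(-)^× ↠ ord((-)^×)` (naturality of
`B₀ → Φ₀^gp` along `Spec K → Spec L`). [cite: MochizukiFrdII2008, Ex 1.1 (i) p.7] -/
theorem ordUnitsMap_ordUnitsMk (x : Lˣ) :
    ordUnitsMap K L (ordUnitsMk L x) = ordUnitsMk K (unitsMap K L x) := rfl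

/-- The restriction maps commute with the inclusions `ord(O^⊳) ⊆ ord((-)^×)`.
[cite: MochizukiFrdII2008, Ex 1.1 (i) p.7] -/
theorem ordUnitsMap_ordIntToOrdUnits (a : OrdInt L) :
    ordUnitsMap K L (ordIntToOrdUnits L a) = ordIntToOrdUnits K (ordIntMap K L a) := by
  obtain ⟨x, rfl⟩ := Associates.mk_surjective a
  rw [ordIntToOrdUnits_mk, ordIntMap, associatesMap_mk, ordIntToOrdUnits_mk, ordUnitsMap_ordUnitsMk]
  congr 1
  exact Units.ext rfl

end Extension

end PadicFrd

end Literature.AlgebraicGeometry.Frobenioids
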